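import Literature.MathematicalPhysics.QuantumFieldTheory.Balaban1983to89.B9Thm311DeltaPrimeSymm
import Mathlib.Analysis.Matrix.Order

/-!
# `Balaban1983to89.B9Thm311InputsAtOne` — row 17 of the N06 knit ([B9] Theorem 3.11): the seven displayed clauses `Inputs311Y₇` are
# JOINTLY SATISFIABLE AT `U = 1` at def-Y's letters of record (the referees' A4 probe), with the parametrix letters G₀ := G(1), R := 0

T. Bałaban, *Propagators for lattice gauge theories in a background field*, Commun. Math. Phys. **99** (1985) 389–434
[`Balaban1985BackgroundPropagators`, "B9"]; [4] = *Propagators … II*, Commun. Math. Phys. **96** (1984) 223–250 [`Balaban1984PropagatorsII`].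

statement-level skeleton of published theorems with citation tags; proofs where landed; nothing here is a claim about the
Yang–Mills mass gap

THE PRINTED LOCI (verbatim).  p. 395: *"Assuming some regularity of the configuration U it can be easily shown that the operator Δ′_a is
positive. This implies positivity of the operators G′, Q′G′²Q′\*, hence the existence of the operator R."*, *"It coincides with Δ_a in (2.19) if
U = 1."*; p. 407, Cor. 3.5: *"for U = 1 these theorems are proved in [4]"*; [4] p. 225: *"The operator G′ = Δ′_a^{−1} is a well defined, positive
operator"*; [4] p. 228: *"The operator G is positive"*; p. 416, Thm 3.11.

WHY THIS FILE.  The whole-statement certificate displays row 17's inputs as ONE ∀U-hypothesis `h311Y₇ : … → Inputs311Y₇ x (lettersYOfRecord …) (𝔔 x) θ₁ M U`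
(`B9Thm311AdjointAtLetters.t311_of_pins_opsYOfRecord₇`).  The referees' A4 probe asks whether such a binder is refutable at the trivial
configuration.  THIS FILE answers it for `U = 1`: with the parametrix letters `G₀ := G(1)`, `R := 0` (so (3.105)–(3.106) read `G₀ = G(I − 0)` and the
smallness clause is `0 ≤ θ₁M⁻¹‖Ψ‖²`) and any `θ₁ ≥ 0`, ALL SEVEN CLAUSES HOLD AT `U = 1` at the letters of record — `pos0` from [4]'s positivity of Δ′_a
(NODE 00's quadratic form `mlOpT_form` + injectivity `mlOpT_mulVec_injective`, lifted to `𝔤 ⊗ ℂ`-valued functions), `symm0` from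
`B9Thm311DeltaPrimeSymm.deltaPrimeAY_parSY_one_isSymmTr`, `unitA` = def-Y's `isUnit_deltaAY_one`, `symmG` ∕ `posG0` from r03's *"G is symmetric … positive"*
(`inner_GE_left`, `inner_GE_pos`) read through `GAY_one : G(1) = (Gop)♯`.  By located finding R7 the binder IS refutable at NON-flat U (def-Y v2's
`symm0`∕`symmG`) until the averaging transporter is repaired; at `U = 1` it is not.

* §1 lifts of real matrices: `dotProduct_onFun`, `isSymmTr_liftOpY`, `trIP_one_liftOpY_eq`, ★ `posDefTr_liftOpY`, `liftEndY_isSymmTr`, `liftEndY_posDefTr`.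
* §2 NODE 00: `dotProduct_mlOpT_mulVec_nonneg`, ★ `dotProduct_mlOpT_mulVec_pos` ([4] p.225), `dotProduct_Gop_symm`, `dotProduct_Gop_pos` ([4] p.228).
* §3 `proofLettersOne`, ★★ `inputs311Y₇_lettersYOfRecord_one` — the seven clauses at `U = 1`, `𝔔₀ := ⟨G(·), 0⟩`, any `θ₁ ≥ 0`, any `M ≥ 0`;
  `inputs311Y_lettersYOfRecord_one` (all nine).

HONEST SCOPE.  A satisfiability witness at the trivial configuration only (A4 defence), no claim at U ≠ 1; finite-dimensional algebra on NODE 00's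
certified objects.  Nothing of [B9] is asserted; NOT a node discharge, NOT summit progress; count-neutral; nothing continuum, nothing about the mass gap.
Cell `pub-ymgap` (HUMAN RULING D-0062), Track A node N06 [B9], seat `pub-ymgap-dag-n06-j` (harness re-seat gen 6), 2026-08-27.
-/

namespace Literature.MathematicalPhysics.QuantumFieldTheory.Balaban1983to89.B9Thm311InputsAtOne

open Literature.MathematicalPhysics.QuantumFieldTheory.Balaban1983to89
open B9Thm311ReadingCoords B9Thm311ReadingAtLetters B9Thm311AdjointAtLetters B9Thm311DeltaPrimeSymm Node00
open B6KLevelCensusIndexV1 B9PinMembersKLevelV1 B7Prop2SpecialUnitary B6MultiLevelBoxOperator B6MultiLevelTorusOperator B6Ineq2133TwoScaleV1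
open scoped Matrix

noncomputable section

/-! ## §1 Lifts of real matrices ∕ endomorphisms to `M_N(ℂ)`-valued functions: symmetry and positivity transfer -/

section Lift

open scoped Matrix.Norms.L2Operator

variable {N : ℕ} {X : Type} [Fintype X]

/-- the dot product against `onFun f` is the `ℓ²` inner product against `f`. [cite: Balaban1984PropagatorsII, (2.22) p.226, dictionary] -/
theorem dotProduct_onFun (f : EuclideanSpace ℝ X →ₗ[ℝ] EuclideanSpace ℝ X) (u v : X → ℝ) :
    u ⬝ᵥ onFun f v = inner ℝ (WithLp.toLp 2 u) (f (WithLp.toLp 2 v)) := by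
  rw [show f (WithLp.toLp 2 v) = WithLp.toLp 2 (onFun f v) from rfl, EuclideanSpace.inner_toLp_toLp, star_trivial, dotProduct_comm]

/-- the lift of a SYMMETRIC real matrix is symmetric for the weight-1 trace pairing (trivial transport in `kernelTrOpY_isSymmTr`).
[cite: Balaban1984PropagatorsII, (2.13)–(2.14) p.225 (a quadratic form), bookkeeping] -/
theorem isSymmTr_liftOpY (M : Matrix X X ℝ) (hM : M.IsSymm) : IsSymmTr (fun _ => (1 : ℝ)) (liftOpY (Matrix (Fin N) (Fin N) ℂ) M) := by
  have h : liftOpY (Matrix (Fin N) (Fin N) ℂ) M = kernelTrOpY (fun z w => M z w) (fun _ _ => (1 : (Matrix (Fin N) (Fin N) ℂ)ˣ)) :=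
    (kernelTrOpY_one _).symm
  rw [h]
  exact kernelTrOpY_isSymmTr _ _ (fun z w => hM.apply w z) (fun _ _ _ => inv_one.symm) fun _ _ _ => (unitary _).one_mem

/-- the weight-1 trace pairing of `Φ` with the lift `M♯Φ` is the sum over the real coordinates `(a, b, c)` of the quadratic forms `v_{abc}ᵀ M v_{abc}`,
`v_{abc}(z) = (Re ∕ Im) Φ(z)_{ab}`. [cite: Balaban1984PropagatorsII, (2.14) p.225, bookkeeping] -/
theorem trIP_one_liftOpY_eq (M : Matrix X X ℝ) (Φ : X → Matrix (Fin N) (Fin N) ℂ) :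
    trIP (fun _ => (1 : ℝ)) Φ (liftOpY (Matrix (Fin N) (Fin N) ℂ) M Φ) =
      ∑ a : Fin N, ∑ b : Fin N, ∑ c : Fin 2, (fun z => cpart c (Φ z a b)) ⬝ᵥ M *ᵥ (fun z => cpart c (Φ z a b)) := by
  unfold trIP
  simp only [one_mul]
  have hentry : ∀ (z : X) (a b : Fin N), (liftOpY (Matrix (Fin N) (Fin N) ℂ) M Φ) z a b = ∑ w, ((M z w : ℝ) : ℂ) * Φ w a b := by
    intro z a b
    change (∑ w, ((M z w : ℝ) : ℂ) • Φ w) a b = _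
    rw [Matrix.sum_apply]
    simp only [Matrix.smul_apply, smul_eq_mul]
  have hre : ∀ (z : X) (a b : Fin N), (star (Φ z a b) * (liftOpY (Matrix (Fin N) (Fin N) ℂ) M Φ) z a b).re =
      ∑ c : Fin 2, ∑ w, M z w * (cpart c (Φ z a b) * cpart c (Φ w a b)) := by
    intro z a b
    rw [hentry, Finset.mul_sum, Complex.re_sum, Finset.sum_comm]
    refine Finset.sum_congr rfl fun w _ => ?_
    rw [← mul_assoc, mul_comm (star (Φ z a b)), mul_assoc, Complex.re_ofReal_mul, ← sum_cpart_mul_cpart, Finset.mul_sum]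
  simp_rw [hre]
  -- `Σ_z Σ_a Σ_b Σ_c F = Σ_a Σ_b Σ_c Σ_z F`
  rw [Finset.sum_comm]
  refine Finset.sum_congr rfl fun a _ => ?_
  rw [Finset.sum_comm]
  refine Finset.sum_congr rfl fun b _ => ?_
  rw [Finset.sum_comm]
  refine Finset.sum_congr rfl fun c _ => ?_
  simp only [dotProduct, Matrix.mulVec, Finset.mul_sum]
  refine Finset.sum_congr rfl fun z _ => Finset.sum_congr rfl fun w _ => ?_
  ring

/-- ★ the lift of a real matrix with POSITIVE DEFINITE quadratic form is `PosDefTr` for the weight-1 trace pairing.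
[cite: Balaban1984PropagatorsII, p.225 («G′ = Δ′_a^{−1} is a well defined, positive operator»), bookkeeping] -/
theorem posDefTr_liftOpY (M : Matrix X X ℝ) (hM : ∀ v : X → ℝ, v ≠ 0 → 0 < v ⬝ᵥ M *ᵥ v) :
    PosDefTr (fun _ => (1 : ℝ)) (liftOpY (Matrix (Fin N) (Fin N) ℂ) M) := by
  intro Φ hΦ
  rw [trIP_one_liftOpY_eq]
  have hnn : ∀ v : X → ℝ, 0 ≤ v ⬝ᵥ M *ᵥ v := by
    intro v
    by_cases hv : v = 0
    · rw [hv, zero_dotProduct]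
    · exact (hM v hv).le
  -- some real coordinate slice of `Φ` is non-zero
  obtain ⟨z, a, b, c, hne⟩ : ∃ (z : X) (a b : Fin N) (c : Fin 2), cpart c (Φ z a b) ≠ 0 := by
    by_contra h
    push Not at h
    apply hΦ
    funext z
    ext a b
    apply Complex.ext
    · simpa using h z a b 0
    · simpa using h z a b 1
  have hv : (fun w => cpart c (Φ w a b)) ≠ 0 := fun h0 => hne (congrFun h0 z)
  have hpos := hM _ hv
  refine lt_of_lt_of_le hpos ?_
  set F : Fin N → Fin N → Fin 2 → ℝ := fun a b c => (fun w => cpart c (Φ w a b)) ⬝ᵥ M *ᵥ (fun w => cpart c (Φ w a b)) with hF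
  have hFnn : ∀ a b c, 0 ≤ F a b c := fun a b c => hnn _
  change F a b c ≤ ∑ a', ∑ b', ∑ c', F a' b' c'
  calc F a b c ≤ ∑ c', F a b c' := Finset.single_le_sum (f := fun c' => F a b c') (fun c' _ => hFnn a b c') (Finset.mem_univ c)
    _ ≤ ∑ b', ∑ c', F a b' c' :=
        Finset.single_le_sum (f := fun b' => ∑ c', F a b' c') (fun b' _ => Finset.sum_nonneg fun c' _ => hFnn a b' c') (Finset.mem_univ b)
    _ ≤ ∑ a', ∑ b', ∑ c', F a' b' c' :=
        Finset.single_le_sum (f := fun a' => ∑ b', ∑ c', F a' b' c')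
          (fun a' _ => Finset.sum_nonneg fun b' _ => Finset.sum_nonneg fun c' _ => hFnn a' b' c') (Finset.mem_univ a)

variable [DecidableEq X]

/-- the lift of a real endomorphism symmetric for the dot product is symmetric for the trace pairing. [cite: Balaban1984PropagatorsII, (2.22) p.226, bookkeeping] -/
theorem liftEndY_isSymmTr (T : Module.End ℝ (X → ℝ)) (hT : ∀ u v : X → ℝ, u ⬝ᵥ T v = T u ⬝ᵥ v) :
    IsSymmTr (fun _ => (1 : ℝ)) (liftEndY (Matrix (Fin N) (Fin N) ℂ) T) := by
  refine isSymmTr_liftOpY _ (Matrix.IsSymm.ext_iff.2 fun z w => ?_)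
  have h := hT (Pi.single z 1) (Pi.single w 1)
  rw [single_dotProduct, dotProduct_single, one_mul, mul_one] at h
  rw [LinearMap.toMatrix'_apply, LinearMap.toMatrix'_apply]
  exact h.symm

/-- the lift of a real endomorphism with positive definite quadratic form is `PosDefTr`. [cite: Balaban1984PropagatorsII, p.228 («The operator G is positive»), bookkeeping] -/
theorem liftEndY_posDefTr (T : Module.End ℝ (X → ℝ)) (hT : ∀ v : X → ℝ, v ≠ 0 → 0 < v ⬝ᵥ T v) :
    PosDefTr (fun _ => (1 : ℝ)) (liftEndY (Matrix (Fin N) (Fin N) ℂ) T) :=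
  posDefTr_liftOpY _ fun v hv => by rw [LinearMap.toMatrix'_mulVec]; exact hT v hv

end Lift

/-! ## §2 NODE 00: `Δ′_a` ([4] p.225) and `G = Δ_a⁻¹` ([4] p.228) are symmetric positive for the dot product -/

section Node00

variable {d ℓ : ℕ} {hd : 1 ≤ d + 1} {hL : Odd (ℓ + 1) ∧ 1 < ℓ + 1} {b₀ b₁ : ℝ}
variable (i : KIdx d ℓ hd hL b₀ b₁)

/-- `⟨v, Δ′_av⟩ ≥ 0` on the torus (a sum of squares, `mlOpT_form`). [cite: Balaban1984PropagatorsII, (2.13)–(2.14) p.225] -/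
theorem dotProduct_mlOpT_mulVec_nonneg (v : SiteY i → ℝ) :
    0 ≤ v ⬝ᵥ mlOpT (toKT i).NB ℓ (toKT i).k (toKT i).D.lev (aPrinted ℓ 1) *ᵥ v := by
  have ha : ∀ j, 0 ≤ aPrinted ℓ 1 j := by
    intro j
    rcases Nat.eq_zero_or_pos j with rfl | hj
    · simp [aPrinted, B1.aSeq]
    · exact (B6Prop23KLevelTorusCensus.aPrinted_pos (B9Cor35AtOneInverseLetters.one_le_ell i) j hj).le
  have hlevC : ∀ j, 0 ≤ levC d ℓ (aPrinted ℓ 1) j := fun j => by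
    unfold levC
    exact mul_nonneg (mul_nonneg (ha j) (inv_nonneg.2 (by positivity))) (inv_nonneg.2 (by positivity))
  rw [mlOpT_form]
  exact add_nonneg (Finset.sum_nonneg fun μ _ => Finset.sum_nonneg fun x _ => sq_nonneg _)
    (Finset.sum_nonneg fun j _ => mul_nonneg (hlevC j) (Finset.sum_nonneg fun β _ => sq_nonneg _))

/-- ★ **`Δ′_a` IS POSITIVE DEFINITE ON THE TORUS** ([4] p.225: *"G′ = Δ′_a^{−1} is a well defined, positive operator"*): a non-negative quadratic form of a
symmetric matrix with trivial kernel (`mlOpT_mulVec_injective`). [cite: Balaban1984PropagatorsII, p.225] -/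
theorem dotProduct_mlOpT_mulVec_pos (v : SiteY i → ℝ) (hv : v ≠ 0) :
    0 < v ⬝ᵥ mlOpT (toKT i).NB ℓ (toKT i).k (toKT i).D.lev (aPrinted ℓ 1) *ᵥ v := by
  set M := mlOpT (toKT i).NB ℓ (toKT i).k (toKT i).D.lev (aPrinted ℓ 1) with hMdef
  have hH : M.IsHermitian := by
    rw [Matrix.IsHermitian, Matrix.conjTranspose_eq_transpose_of_trivial]
    exact mlOpT_isSymm ℓ (toKT i).k (toKT i).D.lev (aPrinted ℓ 1)
  have hpsd : M.PosSemidef :=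
    Matrix.posSemidef_iff_dotProduct_mulVec.2 ⟨hH, fun x => by rw [star_trivial]; exact dotProduct_mlOpT_mulVec_nonneg i x⟩
  refine lt_of_le_of_ne (dotProduct_mlOpT_mulVec_nonneg i v) fun h0 => hv ?_
  have hz : M *ᵥ v = 0 := (hpsd.dotProduct_mulVec_zero_iff v).1 (by rw [star_trivial]; exact h0.symm)
  exact Matrix.mulVec_injective_iff_isUnit.2 (B9Cor35AtOneInverseLetters.isUnit_mlOpT i) (by rw [hz, Matrix.mulVec_zero])

/-- r03's `G = Δ_a⁻¹` read on fine-bond functions is symmetric for the dot product ([4] (2.22): *"G is symmetric"*; `inner_GE_left`).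
[cite: Balaban1984PropagatorsII, (2.22) p.226] -/
theorem dotProduct_Gop_symm (u v : FBondY i → ℝ) :
    u ⬝ᵥ B6Prop26Census2136KLevelV1.Gop i v = B6Prop26Census2136KLevelV1.Gop i u ⬝ᵥ v := by
  rw [B6Prop26Census2136KLevelV1.Gop, dotProduct_onFun, dotProduct_comm, dotProduct_onFun, ← B6SectAVectorModelV1.inner_GE_left,
    real_inner_comm]

/-- r03's `G = Δ_a⁻¹` is positive definite for the dot product ([4] p.228: *"The operator G is positive"*; `inner_GE_pos`). [cite: Balaban1984PropagatorsII, p.228] -/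
theorem dotProduct_Gop_pos (v : FBondY i → ℝ) (hv : v ≠ 0) : 0 < v ⬝ᵥ B6Prop26Census2136KLevelV1.Gop i v := by
  rw [B6Prop26Census2136KLevelV1.Gop, dotProduct_onFun]
  exact B6SectAVectorModelV1.inner_GE_pos _ _ _ fun h => hv (by simpa using congrArg WithLp.ofLp h)

end Node00

/-! ## §3 The seven clauses at `U = 1` at the letters of record -/

section AtOne

open scoped Matrix.Norms.L2Operator

variable {N : ℕ} (θ : Stage3Params) (Mstar : ℕ)

/-- the satisfiability witness for the free parametrix letters: `G₀ := G(U)` (def-Y's `GA`), `R := 0`. [cite: Balaban1985BackgroundPropagators, (3.105)–(3.106) p.414 (G = G₀(I − R)⁻¹ with R = 0), dictionary] -/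
def proofLettersOne (x : MemberY θ.d₆ θ.ℓ₆ θ.hd' θ.hL' θ.b₀ θ.b₁ Mstar) : ProofLetters311 N x.toKIdx where
  G0 := fun U => (lettersYOfRecord N θ Mstar x).GA U
  R := fun _ => 0

/-- ★★ **THE SEVEN DISPLAYED CLAUSES OF ROW 17 HOLD JOINTLY AT `U = 1` AT THE LETTERS OF RECORD** (A4 probe): for every member `x`, every `θ₁ ≥ 0` and every
`M ≥ 0`, `Inputs311Y₇ x (lettersYOfRecord N θ M⋆ x) (proofLettersOne θ M⋆ x) θ₁ M 1` — Δ′_a(1) positive ([4] p.225) and symmetric, Δ_a(1) invertible, G(1)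
symmetric and positive ([4] p.228), G₀ := G(1) = G(1)(I − 0), `⟨Ψ, 0⟩ ≤ θ₁M⁻¹⟨Ψ, Ψ⟩`.  (At NON-flat U the clauses `symm0`∕`symmG` are refuted by located
finding R7 until def-Y's averaging transporter is repaired — `B9Thm311DeltaPrimeSymm`.) [cite: Balaban1985BackgroundPropagators, Thm 3.11 p.416, p.395 (U = 1), Cor. 3.5 p.407; Balaban1984PropagatorsII, p.225, p.228] -/
theorem inputs311Y₇_lettersYOfRecord_one (x : MemberY θ.d₆ θ.ℓ₆ θ.hd' θ.hL' θ.b₀ θ.b₁ Mstar) {θ₁ M : ℝ} (hθ₁ : 0 ≤ θ₁) (hM : 0 ≤ M) :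
    Inputs311Y₇ x (lettersYOfRecord N θ Mstar x) (proofLettersOne θ Mstar x) θ₁ M (fun _ _ => 1) := by
  have hparS : ∀ z w, (lettersYOfRecord N θ Mstar x).parS (fun _ _ => 1) z w = 1 := (lettersYOfRecord N θ Mstar x).parS_one
  have hparB : ∀ s s', (lettersYOfRecord N θ Mstar x).parB (fun _ _ => 1) s s' = 1 := (lettersYOfRecord N θ Mstar x).parB_one
  have hGp := (lettersYOfRecord N θ Mstar x).Gp_one
  have hGA1 : (lettersYOfRecord N θ Mstar x).GA (fun _ _ => 1) =
      liftEndY (Matrix (Fin N) (Fin N) ℂ) (B6Prop26Census2136KLevelV1.Gop x.toKIdx) := GAY_one x.toKIdx hparS hparB hGp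
  refine ⟨?_, ?_, ?_, ?_, ?_, ?_, ?_⟩
  · -- pos0: Δ′_a(1) = (Δ′_a)♯ positive
    rw [deltaPrimeAY_one x.toKIdx _ hparS]
    exact posDefTr_liftOpY _ (dotProduct_mlOpT_mulVec_pos x.toKIdx)
  · -- symm0
    exact deltaPrimeAY_parSY_one_isSymmTr x.toKIdx
  · -- unitA
    exact isUnit_deltaAY_one x.toKIdx hparS hparB hGp
  · -- symmG
    rw [hGA1]
    exact liftEndY_isSymmTr _ (dotProduct_Gop_symm x.toKIdx)
  · -- posG0 (G₀ := G(1))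
    change PosDefTr (fun _ => (1 : ℝ)) ((lettersYOfRecord N θ Mstar x).GA (fun _ _ => 1))
    rw [hGA1]
    exact liftEndY_posDefTr _ (dotProduct_Gop_pos x.toKIdx)
  · -- fac (R := 0)
    change (lettersYOfRecord N θ Mstar x).GA (fun _ _ => 1) = (lettersYOfRecord N θ Mstar x).GA (fun _ _ => 1) ∘ₗ (1 - 0)
    rw [sub_zero, Module.End.one_eq_id, LinearMap.comp_id]
  · -- small (R := 0)
    intro Ψ
    change trIP (fun _ => (1 : ℝ)) Ψ ((0 : (FBondY x.toKIdx → Matrix (Fin N) (Fin N) ℂ) →ₗ[ℂ] _) Ψ) ≤ _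
    rw [LinearMap.zero_apply, trIP_zero_right]
    have hΨ : 0 ≤ trIP (fun _ => (1 : ℝ)) Ψ Ψ := by
      rw [← norm_sq_realify311 (hw := fun _ => one_pos)]
      exact sq_nonneg _
    exact mul_nonneg (mul_nonneg hθ₁ (inv_nonneg.2 hM)) hΨ

/-- the NINE-clause schema `Inputs311Y` at `U = 1` as well (`adj`, `qps_inj` by `B9Thm311AdjointAtLetters.inputs311Y_of_seven`: the trivial configuration is
`SU(N)`-valued). [cite: Balaban1985BackgroundPropagators, Thm 3.11 p.416, p.395 (U = 1); Balaban1984PropagatorsI, p.25] -/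
theorem inputs311Y_lettersYOfRecord_one (x : MemberY θ.d₆ θ.ℓ₆ θ.hd' θ.hL' θ.b₀ θ.b₁ Mstar) {θ₁ M : ℝ} (hθ₁ : 0 ≤ θ₁) (hM : 0 ≤ M) :
    Inputs311Y x (lettersYOfRecord N θ Mstar x) (proofLettersOne θ Mstar x) θ₁ M (fun _ _ => 1) :=
  inputs311Y_of_seven specialUnitaryUnits_le_unitaryUnits x (lettersYOfRecord N θ Mstar x) (proofLettersOne θ Mstar x) rfl
    (fun _ _ => (specialUnitaryUnits (Fin N)).one_mem) (inputs311Y₇_lettersYOfRecord_one θ Mstar x hθ₁ hM)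

end AtOne

end

end Literature.MathematicalPhysics.QuantumFieldTheory.Balaban1983to89.B9Thm311InputsAtOne
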